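import Literature.MathematicalPhysics.StatisticalMechanics.ComplexSpinInfraredBoundProof
import HarnessLib

/-!
# The Schwinger–Dyson equations of the complex spin system, Lemma 4.7 and the local lower bound
# (4.38) (Salmhofer–Seiler, CMP 139 (1991), (3.44)–(3.46), Thm. 3.18(1), Lemma 4.7, (4.38)–(4.39))

Ninth file of the Salmhofer–Seiler series (`ComplexSpinInfraredBound` … `ComplexSpinInfraredBoundProof`:
Def. 3.1, Remark 3.2, Prop. 3.15, Thm. 3.17, Thm. 3.20, Thm. 3.21 proved).  This file continues the
printed road from the infrared bound (Thm. 3.21) towards chiral long-range order (Thm. 4.8, Cor. 4.9)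
with the paper's second, purely local ingredient: the **Schwinger–Dyson (SD) equations** obtained by
"integration by parts with respect to `σ_x`" (p. 409), the positivity half of Thm. 3.18(1), and the
moment inequality **Lemma 4.7** with its consequence **(4.38)**, the lower bound
`1 - 2m⟨σ_x⟩ ≤ K(N) ∑_{|y-x|=1} ⟨σ_x σ_y⟩`, `K(N) = ∑_k k w_k α_k` (4.39).  Everything is PROVED; no
named fact is introduced.  Honest framing: exact identities and inequalities for a polynomial "spin
system" on a finite torus at `β = 0`; nothing about `β > 0`, the thermodynamic limit, the continuum,
or the summit's `QCD` conjunct.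

WHAT IS PRINTED.
* (p. 409) "Let `B_xy(t) = exp(N W_xy(t))` for all `(x,y) ∈ Λ^{(1)}`, `F_x(z) = exp(N f_x(z))` for all
  `x`, and `L ∈ ℒ` be a finite multiindex.  Then for all `x ∈ Λ`,
  `((N - L_x)/N) ⟨σ^L⟩_Λ = ⟨σ_x f_x'(σ_x) σ^L⟩_Λ + ∑_{y:|y-x|=1} ⟨σ_x σ_y W_xy'(σ_x σ_y) σ^L⟩_Λ` (3.44).
  *Proof.* If `L_x = N`, the right side is zero because `σ_x^{N+1}` appears in the numerator of the
  contour integral.  Let `L_x < N`, then … `σ_x^{L_x-N-1} = -(N-L_x)^{-1} d/dσ_x σ_x^{-N-L_x}` (3.45).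
  Integration by parts with respect to `σ_x` … yields (3.44).  The case `F_x(σ) = exp(2Nmσ)` for all
  `x` and `W_xy = W` will be of special importance; the SD equations then read
  `((N - L_x)/N) ⟨σ^L⟩_Λ = 2m ⟨σ_x σ^L⟩_Λ + ∑_{y:|y-x|=1} ⟨σ_x σ_y W'(σ_x σ_y) σ^L⟩_Λ` (3.46)."
* Thm. 3.18(1) (p. 411): for `w₁ = 1`, `w_k ≥ 0` (`k ∈ {2,…,N}`), `m ≥ 0`: `0 ≤ ⟨σ^L⟩_Λ ≤ 1` (3.59);
  "That `⟨σ^L⟩ ≥ 0` is clear from the monomer-dimer representation because `m ≥ 0` and all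
  `w_k ≥ 0`" (only this half is used and proved here).
* Lemma 4.7 (p. 421): "Let `w_k ≥ 0` for all `k ∈ {0,…,N}`, `w₁ = 1` and `m ≥ 0`.  Then
  `⟨(σ_x σ_{x+e₁})ⁿ⟩ ≤ α_n ⟨σ_x σ_{x+e₁}⟩` (4.28), where
  `α_n = ∏_{p=1}^{n-1} (1 - p/N) / (1 + ∑_{k=2}^{n-1} k w_k ∏_{l=1}^{k-1} (1 - (n-l)/N))` (4.29)",
  proved through `S_{n+1} + ∑_{k=2}^{N-n} k w_k S_{n+k} = (1 - n/N) S_n - R_n - T_n` (4.32),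
  `R_n, T_n ≥ 0` (4.33)–(4.34), the inequality (4.35) and the induction (4.36)–(4.37).
* (4.38)–(4.39) (p. 422, proof of Thm. 4.8): "the … SD equation for `L = 0` … now reads
  `1 = 2m⟨σ_x⟩ + ∑_{k=1}^{N} k w_k ∑_{|y-x|=1} ⟨(σ_x σ_y)^k⟩ ≤ 2m⟨σ_x⟩ + K(N) ∑_{|y-x|=1} ⟨σ_x σ_y⟩`
  (4.38), the inequality comes from application of Lemma 4.7, with `K(N) = ∑_{k=1}^{N} k w_k α_k`
  (4.39), `α₁ = 1`".

ERRATUM (recorded for the cell's errata bank, E6).  (4.29) is printed with an inner SUM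
`∑_{l=1}^{k-1} (1 - (n-l)/N)` in the denominator; the induction (4.36)–(4.37) printed on p. 422 and
the printed values `K(3) = 10/3`, `K(4) = 5 + 8/15` (proof of Cor. 4.9) both require the inner
PRODUCT `∏_{l=1}^{k-1} (1 - (n-l)/N)` (with the sum one would get `K(4) = 4.075`).  We state and
prove the product form, which is what the printed proof proves.

HOW IT IS TYPED (vocabulary of `ComplexSpinInfraredBound`: `Λ = TorusSite ν L`, spins are the
variables of `MvPolynomial Λ ℝ`, `[Φ]_Λ = bracket N m a Φ` = the coefficient of `∏_x σ_x^N` in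
`Φ · (Boltzmann polynomial)` (Remark 3.2), `Z_Λ = partitionFunction`, `⟨Φ⟩_Λ = expect = [Φ]_Λ/Z_Λ`,
site weight `F = e^{2Nmσ}` through its Taylor data, bond weight `B(t) = ∑_k a_k t^k`, `a_0 = 1`).
* "Integration by parts in `σ_x`" is the Euler operator `euler x = σ_x ∂/∂σ_x`: the coefficient of
  `∏ σ^N` in `σ_x ∂_x P` is `N` times that in `P` (`coeff_euler`), and `euler` is a derivation.
  Terms containing `σ_x^{N+1}` ("appear in the numerator", i.e. vanish under `[·]_Λ`) are the
  predicate `HighDeg N x` (`bracket_eq_zero_of_highDeg`).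
* `W = N⁻¹ log B` enters through its Taylor data `w` tied to `a` by the exact relation
  `HasLog N a w`: `k a_k = N ∑_{i+j=k} i w_i a_j` for `1 ≤ k ≤ N`, i.e. `t B'(t) = N t W'(t) B(t)`
  to order `t^N` — all that `B = exp(NW)` means under `[·]_Λ` (Remark 3.2).  `w₁ = 1` is the paper's
  standing normalisation ((2.23), Remark 3.4(4)); with `a_0 = 1` it is `a_1 = N`.
  `omega N w x y = ∑_{j=1}^{N} j w_j (σ_x σ_y)^j = σ_x σ_y W'(σ_x σ_y)` (truncated), and
  `linkSum N w x = ∑_μ (ω(x, x+e_μ) + ω(x-e_μ, x))` is the sum over the `2ν` bonds at `x`.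
* The SD equation is proved at the level of the unnormalised bracket `[·]_Λ` (multiply (3.44) by
  `N Z_Λ`): `N [Φ] = [σ_x ∂_x Φ] + 2Nm [σ_x Φ] + N [linkSum · Φ]` for EVERY observable `Φ`
  (`schwingerDyson`), and (3.46) for monomials (`schwingerDyson_monomial`: `σ_x∂_x σ^L = L_x σ^L`).
  Side `L ≥ 2` of the torus is assumed where the bonds `(x, x ± e_μ)` must join distinct sites.
* Positivity: `NonnegCoeff` (all coefficients `≥ 0`) is preserved by the algebra, the Boltzmann
  polynomial has it for `m ≥ 0`, `a_k ≥ 0` (`k ≤ N`), hence `0 ≤ [Φ]_Λ` for `Φ` with nonnegative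
  coefficients (`bracket_nonneg`) — the first half of (3.59); `a_k ≥ 0` follows from `w_k ≥ 0` and
  `HasLog` (`HasLog.coeff_nonneg`).
* Lemma 4.7 is split into the real-variable induction (4.35) ⇒ (4.36) ⇒ (4.28)
  (`le_sdAlpha_mul_of_sd`, on a sequence `S_n ≥ 0`) and its instance for
  `S_n = [(σ_x σ_y)ⁿ]_Λ`, `y` any of the `2ν` neighbours of `x` (`bracket_pow_le_sdAlpha_mul`); the
  bracket form needs no division by `Z_Λ`.  (4.38) is `partitionFunction_eq_sd` (the equality) and
  `partitionFunction_le_sd` (the inequality `Z ≤ 2m[σ_x] + K(N) ∑_{|y-x|=1} [σ_xσ_y]`), with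
  `sdAlpha` = `α_n` (4.29), `sdK` = `K(N)` (4.39); `HasLog.coeff_pos` (`a_k > 0`) is recorded for the
  sequel (positivity of `Z_Λ`).

## References

* M. Salmhofer, E. Seiler, *Proof of chiral symmetry breaking in strongly coupled lattice gauge
  theory*, Commun. Math. Phys. 139 (1991) 395–432: (3.44)–(3.46) p. 409, Thm. 3.18 p. 411,
  Remark 4.6 / Lemma 4.7 pp. 421–422, Thm. 4.8 (4.38)–(4.39) p. 422. [SalmhoferSeiler1991]
-/

noncomputable section

open MvPolynomial Finset

namespace Literature.MathematicalPhysics.StatisticalMechanics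

open Literature.Probability.LatticeModels (TorusSite)

namespace ComplexSpin

variable {ν L : ℕ}

/-! ### "Integration by parts in `σ_x`": the Euler operator `σ_x ∂/∂σ_x` -/

section Euler

variable {σ : Type*}

/-- The Euler operator `σ_z ∂/∂σ_z` on polynomials — the algebraic form of the integration by
parts (3.45) in the contour integral over `σ_z`. [cite: SalmhoferSeiler1991, (3.45)] -/
def euler (z : σ) (p : MvPolynomial σ ℝ) : MvPolynomial σ ℝ :=
  X z * pderiv z p

/-- `σ_z∂_z` multiplies the coefficient of `σ^d` by `d_z`. [cite: SalmhoferSeiler1991, (3.45) (integration by parts in `σ_z`)] -/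
theorem coeff_euler (z : σ) (p : MvPolynomial σ ℝ) (d : σ →₀ ℕ) :
    coeff d (euler z p) = (d z : ℝ) * coeff d p := by
  classical
  unfold euler
  rw [coeff_X_mul']
  by_cases h : d z = 0
  · have hz : z ∉ d.support := by simp [Finsupp.mem_support_iff, h]
    rw [if_neg hz, h, Nat.cast_zero, zero_mul]
  · have hz : z ∈ d.support := by simp [Finsupp.mem_support_iff, h]
    have hle : Finsupp.single z 1 ≤ d := by
      rw [Finsupp.single_le_iff]; omega
    rw [if_pos hz, coeff_pderiv, tsub_add_cancel_of_le hle]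
    have hdz : (((d - Finsupp.single z 1 : σ →₀ ℕ) z : ℕ) : ℝ) + 1 = (d z : ℝ) := by
      rw [Finsupp.tsub_apply, Finsupp.single_eq_same]
      have : d z - 1 + 1 = d z := by omega
      exact_mod_cast this
    rw [hdz, mul_comm]

/-- `σ_z∂_z` is a derivation. [cite: SalmhoferSeiler1991, (3.45) (integration by parts in `σ_z`)] -/
theorem euler_mul (z : σ) (p q : MvPolynomial σ ℝ) :
    euler z (p * q) = euler z p * q + p * euler z q := by
  unfold euler
  rw [pderiv_mul]
  ring

/-- `σ_z∂_z` is additive. [folklore] -/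
private theorem euler_add (z : σ) (p q : MvPolynomial σ ℝ) :
    euler z (p + q) = euler z p + euler z q := by
  unfold euler
  rw [map_add, mul_add]

/-- `σ_z∂_z 0 = 0`. [folklore] -/
private theorem euler_zero (z : σ) : euler z (0 : MvPolynomial σ ℝ) = 0 := by
  unfold euler
  rw [map_zero, mul_zero]

/-- `σ_z∂_z` commutes with finite sums. [folklore] -/
private theorem euler_sum (z : σ) {ι : Type*} (s : Finset ι) (f : ι → MvPolynomial σ ℝ) :
    euler z (∑ i ∈ s, f i) = ∑ i ∈ s, euler z (f i) := by
  unfold euler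
  rw [map_sum, Finset.mul_sum]

/-- `σ_z∂_z (c Φ) = c σ_z∂_z Φ`. [folklore] -/
private theorem euler_C_mul (z : σ) (c : ℝ) (p : MvPolynomial σ ℝ) :
    euler z (C c * p) = C c * euler z p := by
  unfold euler
  rw [pderiv_C_mul]
  ring

/-- `σ_z∂_z 1 = 0`. [folklore] -/
private theorem euler_one (z : σ) : euler z (1 : MvPolynomial σ ℝ) = 0 := by
  unfold euler
  rw [pderiv_one, mul_zero]

/-- `σ_z∂_z σ^d = d_z σ^d`. [cite: SalmhoferSeiler1991, (3.46) (`σ_x∂_x σ^L = L_x σ^L`)] -/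
theorem euler_monomial (z : σ) (d : σ →₀ ℕ) (c : ℝ) :
    euler z (monomial d c) = C (d z : ℝ) * monomial d c := by
  unfold euler
  rw [X_mul_pderiv_monomial, C_mul_monomial, smul_monomial, nsmul_eq_mul]

/-- Two polynomials agree iff all their coefficients do; `σ_z∂_z Φ = c Φ` when every monomial of
`Φ` has `z`-degree `c`. [folklore] -/
private theorem euler_eq_C_mul_of_coeff (z : σ) (p : MvPolynomial σ ℝ) (c : ℕ)
    (h : ∀ d, coeff d p ≠ 0 → d z = c) : euler z p = C (c : ℝ) * p := by
  ext d
  rw [coeff_euler, coeff_C_mul]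
  by_cases hd : coeff d p = 0
  · rw [hd, mul_zero, mul_zero]
  · rw [h d hd]

/-! ### Terms containing `σ_z^{N+1}` vanish under `[·]_Λ` -/

/-- "`σ_z^{N+1}` appears in the numerator": every monomial of `p` has `z`-degree `> N`.
[cite: SalmhoferSeiler1991, proof of (3.44)] -/
def HighDeg (N : ℕ) (z : σ) (p : MvPolynomial σ ℝ) : Prop :=
  ∀ d, coeff d p ≠ 0 → N < d z

/-- `0` is high. [folklore] -/
private theorem HighDeg.zero (N : ℕ) (z : σ) : HighDeg N z (0 : MvPolynomial σ ℝ) :=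
  fun d h => (h (coeff_zero d)).elim

/-- Sums of high polynomials are high. [folklore] -/
private theorem HighDeg.add {N : ℕ} {z : σ} {p q : MvPolynomial σ ℝ} (hp : HighDeg N z p)
    (hq : HighDeg N z q) : HighDeg N z (p + q) := by
  intro d hd
  rw [coeff_add] at hd
  by_cases h1 : coeff d p = 0
  · rw [h1, zero_add] at hd
    exact hq d hd
  · exact hp d h1

/-- Negatives of high polynomials are high. [folklore] -/
private theorem HighDeg.neg {N : ℕ} {z : σ} {p : MvPolynomial σ ℝ} (hp : HighDeg N z p) :
    HighDeg N z (-p) := by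
  intro d hd
  rw [coeff_neg] at hd
  exact hp d (neg_ne_zero.mp hd)

/-- High polynomials form an ideal: `q · p` is high if `p` is. [folklore] -/
private theorem HighDeg.mul_left {N : ℕ} {z : σ} {p : MvPolynomial σ ℝ} (hp : HighDeg N z p)
    (q : MvPolynomial σ ℝ) : HighDeg N z (q * p) := by
  classical
  intro d hd
  rw [coeff_mul] at hd
  obtain ⟨x, hx, hne⟩ := Finset.exists_ne_zero_of_sum_ne_zero hd
  have h2 : coeff x.2 p ≠ 0 := fun h => hne (by rw [h, mul_zero])
  have hlt := hp x.2 h2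
  have hx' : x.1 + x.2 = d := by simpa [Finset.mem_antidiagonal] using hx
  have : x.2 z ≤ d z := by
    rw [← hx', Finsupp.add_apply]
    omega
  omega

/-- `p · q` is high if `p` is. [folklore] -/
private theorem HighDeg.mul_right {N : ℕ} {z : σ} {p : MvPolynomial σ ℝ} (hp : HighDeg N z p)
    (q : MvPolynomial σ ℝ) : HighDeg N z (p * q) := by
  rw [mul_comm]
  exact hp.mul_left q

/-- Finite sums of high polynomials are high. [folklore] -/
private theorem HighDeg.sum {N : ℕ} {z : σ} {ι : Type*} (s : Finset ι) (f : ι → MvPolynomial σ ℝ)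
    (h : ∀ i ∈ s, HighDeg N z (f i)) : HighDeg N z (∑ i ∈ s, f i) := by
  classical
  induction s using Finset.induction_on with
  | empty => rw [Finset.sum_empty]; exact HighDeg.zero N z
  | @insert a s ha ih =>
    rw [Finset.sum_insert ha]
    exact (h a (Finset.mem_insert_self a s)).add
      (ih fun i hi => h i (Finset.mem_insert_of_mem hi))

/-- `σ_z^{N+1} · q` is high. [folklore] -/
private theorem HighDeg.X_pow_mul (N : ℕ) (z : σ) (q : MvPolynomial σ ℝ) :
    HighDeg N z (X z ^ (N + 1) * q) := by
  classical
  have h : HighDeg N z (X z ^ (N + 1) : MvPolynomial σ ℝ) := by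
    intro d hd
    rw [coeff_X_pow] at hd
    by_cases he : Finsupp.single z (N + 1) = d
    · rw [← he, Finsupp.single_eq_same]; omega
    · exact (hd (if_neg he)).elim
  exact h.mul_right q

end Euler

/-! ### The bond polynomial `σ_xσ_y W'(σ_xσ_y)` and the sum over the bonds at a site -/

/-- `σ_x σ_y W'(σ_x σ_y) = ∑_{j=1}^{N} j w_j (σ_x σ_y)^j`, truncated at degree `N` (Remark 3.2); the
`j = 0` term is zero and kept for uniformity with `bondWeight`. [cite: SalmhoferSeiler1991, (3.46)] -/
def omega (N : ℕ) (w : ℕ → ℝ) (x y : TorusSite ν L) : MvPolynomial (TorusSite ν L) ℝ :=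
  ∑ j ∈ range (N + 1), C ((j : ℝ) * w j) * (X x * X y) ^ j

/-- `ω` is symmetric in the bond. [cite: SalmhoferSeiler1991, (3.46)] -/
theorem omega_comm (N : ℕ) (w : ℕ → ℝ) (x y : TorusSite ν L) : omega N w x y = omega N w y x := by
  unfold omega
  simp_rw [mul_comm (X x) (X y)]

/-- The sum of `σ_xσ_y W'(σ_xσ_y)` over the `2ν` bonds of the torus at `x` (the bonds `(x, x+e_μ)`
and `(x-e_μ, x)` of the link enumeration), i.e. `∑_{y : |y-x| = 1} σ_x σ_y W'(σ_x σ_y)` of (3.46).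
[cite: SalmhoferSeiler1991, (3.46)] -/
def linkSum (N : ℕ) (w : ℕ → ℝ) (x : TorusSite ν L) : MvPolynomial (TorusSite ν L) ℝ :=
  ∑ μ : Fin ν, (omega N w x (x + Pi.single μ 1) + omega N w (x - Pi.single μ 1) x)

/-- The `2ν` neighbours `x ± e_μ` of `x`, indexed by a direction and a sign.
[cite: SalmhoferSeiler1991, (3.46)] -/
def nbr (x : TorusSite ν L) (s : Fin ν × Bool) : TorusSite ν L :=
  if s.2 then x + Pi.single s.1 1 else x - Pi.single s.1 1

/-- `∑_{y:|y-x|=1} σ_xσ_y W'(σ_xσ_y) = ∑_{s} ω(x, nbr x s)`. [cite: SalmhoferSeiler1991, (3.46)] -/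
theorem linkSum_eq_sum_nbr (N : ℕ) (w : ℕ → ℝ) (x : TorusSite ν L) :
    linkSum N w x = ∑ s : Fin ν × Bool, omega N w x (nbr x s) := by
  rw [linkSum, Fintype.sum_prod_type]
  refine Finset.sum_congr rfl fun μ _ => ?_
  rw [Fintype.sum_bool]
  simp only [nbr, if_true, Bool.false_eq_true, if_false]
  rw [omega_comm N w (x - Pi.single μ 1) x]

/-! ### `W = N⁻¹ log B` through its Taylor data -/

/-- **`B = exp(N W)` to order `N`**: the Taylor data `a` of the bond weight `B(t) = ∑ a_k t^k` and
`w` of `W(t) = ∑_{k ≥ 1} w_k t^k` satisfy `t B'(t) = N t W'(t) B(t)` up to degree `N`, i.e.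
`k a_k = N ∑_{i+j=k} i w_i a_j` for `1 ≤ k ≤ N` — which, with `a_0 = 1 = B(0)`, is exactly
"`B(t) = exp(N W(t))` modulo `t^{N+1}`", all that matters under `[·]_Λ` (Remark 3.2).
[cite: SalmhoferSeiler1991, (3.44) and Remark 3.2] -/
def HasLog (N : ℕ) (a w : ℕ → ℝ) : Prop :=
  ∀ k, 1 ≤ k → k ≤ N →
    (k : ℝ) * a k = N * ∑ p ∈ HasAntidiagonal.antidiagonal k, (p.1 : ℝ) * w p.1 * a p.2

/-- With `B(0) = a_0 = 1`, the degree-one case of `B = exp(NW)` reads `a_1 = N w₁`; so the paper's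
normalisation `w₁ = 1` is `a_1 = N`. [cite: SalmhoferSeiler1991, (2.23) and Remark 3.4(4)] -/
theorem HasLog.a_one {N : ℕ} {a w : ℕ → ℝ} (h : HasLog N a w) (hN : 1 ≤ N) (ha0 : a 0 = 1) :
    a 1 = N * w 1 := by
  have := h 1 le_rfl hN
  rw [Finset.Nat.antidiagonal_succ, Finset.sum_cons, Finset.Nat.antidiagonal_zero,
    Finset.map_singleton, Finset.sum_singleton] at this
  simp only [Nat.cast_zero, zero_mul, Function.Embedding.coe_prodMap,
    Function.Embedding.coeFn_mk, Prod.map_apply, Nat.succ_eq_add_one, zero_add, Nat.cast_one,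
    one_mul, Function.Embedding.refl_apply, ha0, mul_one] at this
  linarith

/-- **`w_k ≥ 0 ⇒ a_k ≥ 0`**: if `w₁ ≥ 0` and `w_k ≥ 0` for `2 ≤ k ≤ N` then the Taylor coefficients
of `B = exp(NW)` are nonnegative up to degree `N` ("the monomer-dimer representation", proof of
Thm. 3.18(1)). [cite: SalmhoferSeiler1991, proof of Thm. 3.18(1)] -/
theorem HasLog.coeff_nonneg {N : ℕ} {a w : ℕ → ℝ} (h : HasLog N a w) (ha0 : a 0 = 1)
    (hw : ∀ k, 1 ≤ k → k ≤ N → 0 ≤ w k) : ∀ k ≤ N, 0 ≤ a k := by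
  intro k
  induction k using Nat.strong_induction_on with
  | _ k ih =>
    intro hk
    rcases Nat.eq_zero_or_pos k with rfl | hk1
    · rw [ha0]; exact zero_le_one
    · have hkey := h k hk1 hk
      have hsum : 0 ≤ ∑ p ∈ HasAntidiagonal.antidiagonal k, (p.1 : ℝ) * w p.1 * a p.2 := by
        refine Finset.sum_nonneg fun p hp => ?_
        have hp' : p.1 + p.2 = k := HasAntidiagonal.mem_antidiagonal.mp hp
        rcases Nat.eq_zero_or_pos p.1 with h0 | h1
        · rw [h0, Nat.cast_zero, zero_mul, zero_mul]
        · have hw' := hw p.1 h1 (by omega)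
          have ha' := ih p.2 (by omega) (by omega)
          positivity
      have hkpos : (0 : ℝ) < k := Nat.cast_pos.mpr hk1
      have h2 : (k : ℝ) * 0 ≤ (k : ℝ) * a k := by rw [mul_zero, hkey]; positivity
      exact le_of_mul_le_mul_left h2 hkpos

/-- **`w₁ = 1`, `w_k ≥ 0 ⇒ a_k ≥ N^k/k! > 0`**: in particular `a_k > 0` for `k ≤ N`
(`B(t) = e^{Nt} e^{N(W(t)-t)}` with the second factor having nonnegative coefficients).
[cite: SalmhoferSeiler1991, proof of Thm. 3.18(1)] -/
theorem HasLog.coeff_pos {N : ℕ} {a w : ℕ → ℝ} (h : HasLog N a w) (hN : 1 ≤ N) (ha0 : a 0 = 1)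
    (hw1 : w 1 = 1) (hw : ∀ k, 2 ≤ k → k ≤ N → 0 ≤ w k) : ∀ k ≤ N, 0 < a k := by
  have hw' : ∀ k, 1 ≤ k → k ≤ N → 0 ≤ w k := by
    intro k hk1 hkN
    rcases Nat.lt_or_ge k 2 with hk | hk
    · have : k = 1 := by omega
      rw [this, hw1]; exact zero_le_one
    · exact hw k hk hkN
  have hnn := h.coeff_nonneg ha0 hw'
  intro k
  induction k with
  | zero => intro _; rw [ha0]; exact zero_lt_one
  | succ k ih =>
    intro hk
    have hkey := h (k + 1) (by omega) hk
    -- the `i = 1` term of the antidiagonal sum is `N w₁ a_k = N a_k > 0`, the others are `≥ 0`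
    have hsum : (1 : ℝ) * w 1 * a k ≤
        ∑ p ∈ HasAntidiagonal.antidiagonal (k + 1), (p.1 : ℝ) * w p.1 * a p.2 := by
      have hmem : ((1, k) : ℕ × ℕ) ∈ HasAntidiagonal.antidiagonal (k + 1) := by
        rw [HasAntidiagonal.mem_antidiagonal]; omega
      rw [← Finset.add_sum_erase _ _ hmem]
      simp only [Nat.cast_one]
      have : 0 ≤ ∑ p ∈ (HasAntidiagonal.antidiagonal (k + 1)).erase (1, k), (p.1 : ℝ) * w p.1 * a p.2 := by
        refine Finset.sum_nonneg fun p hp => ?_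
        have hp' : p.1 + p.2 = k + 1 := HasAntidiagonal.mem_antidiagonal.mp (Finset.mem_of_mem_erase hp)
        rcases Nat.eq_zero_or_pos p.1 with h0 | h1
        · rw [h0, Nat.cast_zero, zero_mul, zero_mul]
        · have hw'' := hw' p.1 h1 (by omega)
          have ha'' := hnn p.2 (by omega)
          positivity
      linarith
    rw [hw1, one_mul, one_mul] at hsum
    have hak : 0 < a k := ih (by omega)
    have hNpos : (0 : ℝ) < N := Nat.cast_pos.mpr hN
    have h1 : (0 : ℝ) < N * ∑ p ∈ HasAntidiagonal.antidiagonal (k + 1), (p.1 : ℝ) * w p.1 * a p.2 :=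
      mul_pos hNpos (lt_of_lt_of_le hak hsum)
    rw [← hkey] at h1
    have hkpos : (0 : ℝ) < ((k + 1 : ℕ) : ℝ) := Nat.cast_pos.mpr (Nat.succ_pos k)
    have h2 : ((k + 1 : ℕ) : ℝ) * 0 < ((k + 1 : ℕ) : ℝ) * a (k + 1) := by rw [mul_zero]; exact h1
    exact lt_of_mul_lt_mul_left h2 hkpos.le


/-! ### `σ_z∂_z` on the building blocks of the Boltzmann polynomial -/

section Blocks

variable {σ : Type*}

/-- `σ_z∂_z (σ_xσ_y)^k = k_z (σ_xσ_y)^k` with `k_z` the `z`-degree of `(σ_xσ_y)^k`. [folklore] -/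
private theorem euler_XX_pow [DecidableEq σ] (z x y : σ) (k : ℕ) :
    euler z ((X x * X y : MvPolynomial σ ℝ) ^ k) =
      C (((Finsupp.single x k + Finsupp.single y k) z : ℕ) : ℝ) * (X x * X y) ^ k := by
  have hm : (X x * X y : MvPolynomial σ ℝ) ^ k =
      monomial (Finsupp.single x k + Finsupp.single y k) 1 := by
    rw [mul_pow, X_pow_eq_monomial, X_pow_eq_monomial, monomial_mul, mul_one]
  rw [hm, euler_monomial]

/-- `σ_z∂_z σ_x^j = j_z σ_x^j`. [folklore] -/
private theorem euler_X_pow [DecidableEq σ] (z x : σ) (j : ℕ) :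
    euler z ((X x : MvPolynomial σ ℝ) ^ j) = C (((Finsupp.single x j) z : ℕ) : ℝ) * X x ^ j := by
  rw [X_pow_eq_monomial, euler_monomial]

/-- **Leibniz rule over a product, modulo high terms**: if `σ_z∂_z f_i = q_i f_i + h_i` with `h_i`
high for every factor, then `σ_z∂_z ∏ f_i = (∑ q_i) ∏ f_i + H` with `H` high. [folklore] -/
private theorem euler_prod_of {N : ℕ} {z : σ} {ι : Type*} [DecidableEq ι] (s : Finset ι)
    (f q : ι → MvPolynomial σ ℝ)
    (hf : ∀ i ∈ s, ∃ h, HighDeg N z h ∧ euler z (f i) = q i * f i + h) :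
    ∃ H, HighDeg N z H ∧ euler z (∏ i ∈ s, f i) = (∑ i ∈ s, q i) * ∏ i ∈ s, f i + H := by
  induction s using Finset.induction_on with
  | empty =>
    refine ⟨0, HighDeg.zero N z, ?_⟩
    rw [Finset.prod_empty, Finset.sum_empty, euler_one, zero_mul, zero_add]
  | @insert b s hb ih =>
    obtain ⟨H, hH, hprod⟩ := ih fun i hi => hf i (Finset.mem_insert_of_mem hi)
    obtain ⟨h, hh, hfb⟩ := hf b (Finset.mem_insert_self b s)
    refine ⟨h * ∏ i ∈ s, f i + f b * H, (hh.mul_right _).add (hH.mul_left _), ?_⟩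
    rw [Finset.prod_insert hb, Finset.sum_insert hb, euler_mul, hprod, hfb]
    ring

end Blocks

/-- The bond weight is symmetric in the bond. [cite: SalmhoferSeiler1991, Def. 3.1] -/
theorem bondWeight_comm (N : ℕ) (a : ℕ → ℝ) (x y : TorusSite ν L) :
    bondWeight N a x y = bondWeight N a y x := by
  unfold bondWeight
  simp_rw [mul_comm (X x) (X y)]

/-- `σ_z∂_z` kills the weight of a bond not containing `z`. [folklore] -/
private theorem euler_bondWeight_of_ne {z x y : TorusSite ν L} (hx : z ≠ x) (hy : z ≠ y) (N : ℕ)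
    (a : ℕ → ℝ) : euler z (bondWeight N a x y) = 0 := by
  classical
  unfold bondWeight
  rw [euler_sum]
  refine Finset.sum_eq_zero fun k _ => ?_
  rw [euler_C_mul, euler_XX_pow, Finsupp.add_apply, Finsupp.single_eq_of_ne hx,
    Finsupp.single_eq_of_ne hy, add_zero, Nat.cast_zero, C_0, zero_mul, mul_zero]

/-- `σ_z∂_z` kills the site weight of a site `x ≠ z`. [folklore] -/
private theorem euler_siteWeight_of_ne {z x : TorusSite ν L} (hx : z ≠ x) (N : ℕ) (m : ℝ) :
    euler z (siteWeight N m x) = 0 := by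
  classical
  unfold siteWeight
  rw [euler_sum]
  refine Finset.sum_eq_zero fun j _ => ?_
  rw [euler_C_mul, euler_X_pow, Finsupp.single_eq_of_ne hx, Nat.cast_zero, C_0, zero_mul,
    mul_zero]

/-- **`σ_z∂_z F(σ_z) = 2Nm σ_z F(σ_z)` modulo `σ_z^{N+1}`** for the truncated site weight
`F = e^{2Nmσ}` (`σ_x f_x'(σ_x) = 2mσ_x` in (3.44)/(3.46)): `j c_j = 2Nm c_{j-1}` for the Taylor
coefficients `c_j = (2Nm)^j/j!`. [cite: SalmhoferSeiler1991, (3.46)] -/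
theorem euler_siteWeight_self (N : ℕ) (m : ℝ) (z : TorusSite ν L) :
    ∃ h, HighDeg N z h ∧
      euler z (siteWeight N m z) = C (2 * N * m) * X z * siteWeight N m z + h := by
  classical
  set c : ℕ → ℝ := fun j => (2 * N * m) ^ j / (Nat.factorial j : ℝ) with hc
  refine ⟨-(C (2 * N * m * c N) * X z ^ (N + 1)), ?_, ?_⟩
  · have : -(C (2 * N * m * c N) * X z ^ (N + 1)) =
        X z ^ (N + 1) * (-C (2 * N * m * c N) : MvPolynomial (TorusSite ν L) ℝ) := by ring
    rw [this]
    exact HighDeg.X_pow_mul N z _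
  · have hsw : siteWeight (ν := ν) (L := L) N m z = ∑ j ∈ range (N + 1), C (c j) * X z ^ j := rfl
    have hterm : ∀ j : ℕ, C (c (j + 1)) * (C (((j + 1 : ℕ) : ℕ) : ℝ) * X z ^ (j + 1)) =
        C (2 * N * m) * X z * (C (c j) * X z ^ j) := by
      intro j
      have hcj : c (j + 1) * ((j + 1 : ℕ) : ℝ) = 2 * N * m * c j := by
        simp only [hc, Nat.factorial_succ, Nat.cast_mul, pow_succ]
        have hj : ((Nat.factorial j : ℕ) : ℝ) ≠ 0 := by positivity
        have hj1 : ((j + 1 : ℕ) : ℝ) ≠ 0 := by positivity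
        field_simp
      calc C (c (j + 1)) * (C (((j + 1 : ℕ) : ℕ) : ℝ) * X z ^ (j + 1))
          = C (c (j + 1) * ((j + 1 : ℕ) : ℝ)) * X z ^ (j + 1) := by rw [map_mul]; ring
        _ = C (2 * N * m * c j) * X z ^ (j + 1) := by rw [hcj]
        _ = C (2 * N * m) * X z * (C (c j) * X z ^ j) := by rw [map_mul, pow_succ]; ring
    have hlast : C (2 * N * m) * X z * (C (c N) * X z ^ N) =
        C (2 * N * m * c N) * X z ^ (N + 1) := by
      rw [show C (2 * N * m * c N) = C (2 * N * m) * C (c N) from map_mul C _ _, pow_succ]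
      ring
    rw [hsw, euler_sum, Finset.mul_sum]
    simp_rw [euler_C_mul, euler_X_pow, Finsupp.single_eq_same]
    rw [Finset.sum_range_succ' _ N, Finset.sum_range_succ _ N, pow_zero, Nat.cast_zero, C_0,
      zero_mul, mul_zero, add_zero]
    simp_rw [hterm]
    rw [hlast]
    ring

/-! ### The univariate identity `t B'(t) ≡ N t W'(t) B(t) (mod t^{N+1})` -/

/-- Truncated univariate generating polynomial `∑_{i ≤ N} f_i X^i`. [folklore] -/
private def uniPoly (N : ℕ) (f : ℕ → ℝ) : Polynomial ℝ :=
  ∑ i ∈ range (N + 1), Polynomial.C (f i) * Polynomial.X ^ i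

/-- Coefficients of the truncated generating polynomial. [folklore] -/
private theorem coeff_uniPoly (N : ℕ) (f : ℕ → ℝ) (k : ℕ) :
    (uniPoly N f).coeff k = if k < N + 1 then f k else 0 := by
  unfold uniPoly
  rw [Polynomial.finsetSum_coeff]
  simp_rw [Polynomial.coeff_C_mul_X_pow]
  rw [Finset.sum_ite_eq (range (N + 1)) k]
  simp only [Finset.mem_range]

/-- Evaluating the truncated generating polynomial at `T = σ_xσ_y`. [folklore] -/
private theorem aeval_uniPoly (N : ℕ) (f : ℕ → ℝ) (T : MvPolynomial (TorusSite ν L) ℝ) :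
    Polynomial.aeval T (uniPoly N f) = ∑ i ∈ range (N + 1), C (f i) * T ^ i := by
  unfold uniPoly
  rw [map_sum]
  refine Finset.sum_congr rfl fun i _ => ?_
  rw [map_mul, map_pow, Polynomial.aeval_C, Polynomial.aeval_X, MvPolynomial.algebraMap_eq]

/-- `t B'(t) - N t W'(t) B(t)` is divisible by `t^{N+1}` under `HasLog` — the coefficient form of
`B = exp(NW)` to order `N`. [cite: SalmhoferSeiler1991, (3.44) and Remark 3.2] -/
private theorem X_pow_dvd_of_hasLog {N : ℕ} {a w : ℕ → ℝ} (hlog : HasLog N a w) :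
    Polynomial.X ^ (N + 1) ∣
      Polynomial.C (N : ℝ) * uniPoly N (fun j => (j : ℝ) * w j) * uniPoly N a -
        uniPoly N (fun k => (k : ℝ) * a k) := by
  rw [Polynomial.X_pow_dvd_iff]
  intro d hd
  rw [Polynomial.coeff_sub, mul_assoc, Polynomial.coeff_C_mul, Polynomial.coeff_mul,
    coeff_uniPoly, if_pos hd]
  have h1 : ∑ p ∈ HasAntidiagonal.antidiagonal d,
      (uniPoly N (fun j => (j : ℝ) * w j)).coeff p.1 * (uniPoly N a).coeff p.2 =
      ∑ p ∈ HasAntidiagonal.antidiagonal d, (p.1 : ℝ) * w p.1 * a p.2 := by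
    refine Finset.sum_congr rfl fun p hp => ?_
    have hp' : p.1 + p.2 = d := HasAntidiagonal.mem_antidiagonal.mp hp
    rw [coeff_uniPoly, coeff_uniPoly, if_pos (by omega), if_pos (by omega)]
  rw [h1]
  rcases Nat.eq_zero_or_pos d with rfl | hd1
  · rw [Finset.Nat.antidiagonal_zero, Finset.sum_singleton]
    simp
  · rw [← hlog d hd1 (by omega), sub_self]

/-- **`σ_xσ_y B'(σ_xσ_y) = N σ_xσ_y W'(σ_xσ_y) B(σ_xσ_y)` modulo `σ_x^{N+1}`**: the Euler operator
at `x` on the weight of a bond `(x, y)`, `x ≠ y`. [cite: SalmhoferSeiler1991, (3.44)] -/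
theorem euler_bondWeight_left {N : ℕ} {a w : ℕ → ℝ} (hlog : HasLog N a w)
    {x y : TorusSite ν L} (hxy : x ≠ y) :
    ∃ h, HighDeg N x h ∧
      euler x (bondWeight N a x y) = C (N : ℝ) * omega N w x y * bondWeight N a x y + h := by
  classical
  obtain ⟨Q, hQ⟩ := X_pow_dvd_of_hasLog hlog
  set T : MvPolynomial (TorusSite ν L) ℝ := X x * X y with hT
  refine ⟨-(T ^ (N + 1) * Polynomial.aeval T Q), ?_, ?_⟩
  · have : -(T ^ (N + 1) * Polynomial.aeval T Q) =
        X x ^ (N + 1) * (-(X y ^ (N + 1) * Polynomial.aeval T Q)) := by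
      rw [hT, mul_pow]; ring
    rw [this]
    exact HighDeg.X_pow_mul N x _
  · have hD : euler x (bondWeight N a x y) =
        Polynomial.aeval T (uniPoly N fun k => (k : ℝ) * a k) := by
      rw [aeval_uniPoly, bondWeight, euler_sum]
      refine Finset.sum_congr rfl fun k _ => ?_
      rw [euler_C_mul, euler_XX_pow, Finsupp.add_apply, Finsupp.single_eq_same,
        Finsupp.single_eq_of_ne hxy, add_zero, ← mul_assoc, ← map_mul, mul_comm (a k)]
    have hA : Polynomial.aeval T (uniPoly N a) = bondWeight N a x y := by
      rw [aeval_uniPoly]; rfl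
    have hΩ : Polynomial.aeval T (uniPoly N fun j => (j : ℝ) * w j) = omega N w x y := by
      rw [aeval_uniPoly]; rfl
    have h := congrArg (Polynomial.aeval T) hQ
    rw [map_sub, map_mul, map_mul, Polynomial.aeval_C, MvPolynomial.algebraMap_eq, hA, hΩ, ← hD,
      map_mul, map_pow, Polynomial.aeval_X] at h
    linear_combination (-1 : MvPolynomial (TorusSite ν L) ℝ) * h

/-- The same at the other end of the bond. [cite: SalmhoferSeiler1991, (3.44)] -/
theorem euler_bondWeight_right {N : ℕ} {a w : ℕ → ℝ} (hlog : HasLog N a w)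
    {x y : TorusSite ν L} (hxy : x ≠ y) :
    ∃ h, HighDeg N y h ∧
      euler y (bondWeight N a x y) = C (N : ℝ) * omega N w x y * bondWeight N a x y + h := by
  obtain ⟨h, hh, he⟩ := euler_bondWeight_left (ν := ν) (L := L) hlog hxy.symm
  refine ⟨h, hh, ?_⟩
  rw [bondWeight_comm, he, omega_comm]

/-- On a torus of side `L ≥ 2` the unit vectors are nonzero: `x + e_μ ≠ x`. [folklore] -/
private theorem add_single_ne_self (hL : 2 ≤ L) (x : TorusSite ν L) (μ : Fin ν) :
    x + Pi.single μ (1 : ZMod L) ≠ x := by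
  haveI : Fact (1 < L) := ⟨hL⟩
  intro h
  have h1 : (Pi.single μ (1 : ZMod L) : TorusSite ν L) = 0 := by
    have := congrArg (fun y => y - x) h
    simp only [add_sub_cancel_left, sub_self] at this
    exact this
  have := congrFun h1 μ
  simp at this

/-! ### Positivity: "clear from the monomer–dimer representation" (Thm. 3.18(1), first half) -/

section Nonneg

variable {σ : Type*}

/-- All coefficients of `p` are `≥ 0`. [cite: SalmhoferSeiler1991, proof of Thm. 3.18(1) (nonnegative weights)] -/
def NonnegCoeff (p : MvPolynomial σ ℝ) : Prop :=
  ∀ d, 0 ≤ coeff d p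

/-- `0` has nonnegative coefficients. [cite: SalmhoferSeiler1991, proof of Thm. 3.18(1) (nonnegative weights)] -/
theorem NonnegCoeff.zero : NonnegCoeff (0 : MvPolynomial σ ℝ) :=
  fun d => by rw [coeff_zero]

/-- A constant `c ≥ 0` has nonnegative coefficients. [cite: SalmhoferSeiler1991, proof of Thm. 3.18(1) (nonnegative weights)] -/
theorem NonnegCoeff.C {c : ℝ} (hc : 0 ≤ c) : NonnegCoeff (C c : MvPolynomial σ ℝ) := by
  classical
  intro d
  rw [coeff_C]
  split_ifs
  · exact hc
  · exact le_rfl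

/-- `1` has nonnegative coefficients. [cite: SalmhoferSeiler1991, proof of Thm. 3.18(1) (nonnegative weights)] -/
theorem NonnegCoeff.one : NonnegCoeff (1 : MvPolynomial σ ℝ) := by
  rw [← C_1]; exact NonnegCoeff.C zero_le_one

/-- A variable has nonnegative coefficients. [cite: SalmhoferSeiler1991, proof of Thm. 3.18(1) (nonnegative weights)] -/
theorem NonnegCoeff.X (x : σ) : NonnegCoeff (X x : MvPolynomial σ ℝ) := by
  classical
  intro d
  rw [coeff_X]
  split_ifs
  · exact zero_le_one
  · exact le_rfl

/-- Sums preserve nonnegative coefficients. [cite: SalmhoferSeiler1991, proof of Thm. 3.18(1) (nonnegative weights)] -/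
theorem NonnegCoeff.add {p q : MvPolynomial σ ℝ} (hp : NonnegCoeff p) (hq : NonnegCoeff q) :
    NonnegCoeff (p + q) :=
  fun d => by rw [coeff_add]; exact add_nonneg (hp d) (hq d)

/-- Products preserve nonnegative coefficients. [cite: SalmhoferSeiler1991, proof of Thm. 3.18(1) (nonnegative weights)] -/
theorem NonnegCoeff.mul {p q : MvPolynomial σ ℝ} (hp : NonnegCoeff p) (hq : NonnegCoeff q) :
    NonnegCoeff (p * q) := by
  classical
  intro d
  rw [coeff_mul]
  exact Finset.sum_nonneg fun x _ => mul_nonneg (hp x.1) (hq x.2)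

/-- Finite sums preserve nonnegative coefficients. [cite: SalmhoferSeiler1991, proof of Thm. 3.18(1) (nonnegative weights)] -/
theorem NonnegCoeff.sum {ι : Type*} (s : Finset ι) {f : ι → MvPolynomial σ ℝ}
    (h : ∀ i ∈ s, NonnegCoeff (f i)) : NonnegCoeff (∑ i ∈ s, f i) := by
  classical
  induction s using Finset.induction_on with
  | empty => rw [Finset.sum_empty]; exact NonnegCoeff.zero
  | @insert b s hb ih =>
    rw [Finset.sum_insert hb]
    exact (h b (Finset.mem_insert_self b s)).add (ih fun i hi => h i (Finset.mem_insert_of_mem hi))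

/-- Finite products preserve nonnegative coefficients. [cite: SalmhoferSeiler1991, proof of Thm. 3.18(1) (nonnegative weights)] -/
theorem NonnegCoeff.prod {ι : Type*} (s : Finset ι) {f : ι → MvPolynomial σ ℝ}
    (h : ∀ i ∈ s, NonnegCoeff (f i)) : NonnegCoeff (∏ i ∈ s, f i) := by
  classical
  induction s using Finset.induction_on with
  | empty => rw [Finset.prod_empty]; exact NonnegCoeff.one
  | @insert b s hb ih =>
    rw [Finset.prod_insert hb]
    exact (h b (Finset.mem_insert_self b s)).mul (ih fun i hi => h i (Finset.mem_insert_of_mem hi))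

/-- Powers preserve nonnegative coefficients. [cite: SalmhoferSeiler1991, proof of Thm. 3.18(1) (nonnegative weights)] -/
theorem NonnegCoeff.pow {p : MvPolynomial σ ℝ} (hp : NonnegCoeff p) (n : ℕ) :
    NonnegCoeff (p ^ n) := by
  induction n with
  | zero => rw [pow_zero]; exact NonnegCoeff.one
  | succ n ih => rw [pow_succ]; exact ih.mul hp

end Nonneg

/-- The truncated site weight `e^{2Nmσ}` has nonnegative coefficients for `m ≥ 0`.
[cite: SalmhoferSeiler1991, proof of Thm. 3.18(1)] -/
theorem nonnegCoeff_siteWeight (N : ℕ) {m : ℝ} (hm : 0 ≤ m) (x : TorusSite ν L) :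
    NonnegCoeff (siteWeight N m x) := by
  unfold siteWeight
  refine NonnegCoeff.sum _ fun j _ => ?_
  exact (NonnegCoeff.C (by positivity)).mul ((NonnegCoeff.X x).pow j)

/-- The truncated bond weight has nonnegative coefficients if `a_k ≥ 0`, `k ≤ N`.
[cite: SalmhoferSeiler1991, proof of Thm. 3.18(1)] -/
theorem nonnegCoeff_bondWeight (N : ℕ) {a : ℕ → ℝ} (ha : ∀ k ≤ N, 0 ≤ a k)
    (x y : TorusSite ν L) : NonnegCoeff (bondWeight N a x y) := by
  unfold bondWeight
  refine NonnegCoeff.sum _ fun k hk => ?_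
  have hk' : k ≤ N := Nat.lt_succ_iff.mp (Finset.mem_range.mp hk)
  exact (NonnegCoeff.C (ha k hk')).mul (((NonnegCoeff.X x).mul (NonnegCoeff.X y)).pow k)

/-- `σ_xσ_y W'(σ_xσ_y)` has nonnegative coefficients if `w_k ≥ 0`, `1 ≤ k ≤ N`.
[cite: SalmhoferSeiler1991, proof of Lemma 4.7 ((4.33)–(4.34))] -/
theorem nonnegCoeff_omega (N : ℕ) {w : ℕ → ℝ} (hw : ∀ k, 1 ≤ k → k ≤ N → 0 ≤ w k)
    (x y : TorusSite ν L) : NonnegCoeff (omega N w x y) := by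
  unfold omega
  refine NonnegCoeff.sum _ fun j hj => ?_
  have hj' : j ≤ N := Nat.lt_succ_iff.mp (Finset.mem_range.mp hj)
  refine (NonnegCoeff.C ?_).mul (((NonnegCoeff.X x).mul (NonnegCoeff.X y)).pow j)
  rcases Nat.eq_zero_or_pos j with rfl | hj1
  · simp
  · exact mul_nonneg (Nat.cast_nonneg j) (hw j hj1 hj')

/-! ### Lemma 4.7: the real-variable induction (4.35) ⇒ (4.36) ⇒ (4.28) -/

/-- `P_n(k) = ∏_{l=1}^{k} (1 - (n-l)/N)` of (4.36), written `∏_{i<k} (1 - (n-1-i)/N)` (`l = i+1`).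
[cite: SalmhoferSeiler1991, (4.36)] -/
def sdProd (N n k : ℕ) : ℝ :=
  ∏ i ∈ range k, (1 - ((n - 1 - i : ℕ) : ℝ) / N)

/-- **`α_n` of Lemma 4.7 (4.29)**, product form (see the module docstring's ERRATUM):
`α_n = ∏_{p=1}^{n-1} (1 - p/N) / (1 + ∑_{k=2}^{n-1} k w_k ∏_{l=1}^{k-1} (1 - (n-l)/N))`, the sums and
products written over `range` (`p = i+1`, `k = i+2`).  `α₁ = 1`.
[cite: SalmhoferSeiler1991, (4.29)] -/
def sdAlpha (N : ℕ) (w : ℕ → ℝ) (n : ℕ) : ℝ :=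
  (∏ i ∈ range (n - 1), (1 - ((i + 1 : ℕ) : ℝ) / N)) /
    (1 + ∑ i ∈ range (n - 2), ((i + 2 : ℕ) : ℝ) * w (i + 2) * sdProd N n (i + 1))

/-- **`K(N) = ∑_{k=1}^{N} k w_k α_k` (4.39)** (the `k = 0` term of the `range` sum vanishes).
[cite: SalmhoferSeiler1991, (4.39)] -/
def sdK (N : ℕ) (w : ℕ → ℝ) : ℝ :=
  ∑ k ∈ range (N + 1), (k : ℝ) * w k * sdAlpha N w k

/-- `α₁ = 1`. [cite: SalmhoferSeiler1991, (4.39)] -/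
theorem sdAlpha_one (N : ℕ) (w : ℕ → ℝ) : sdAlpha N w 1 = 1 := by
  simp [sdAlpha]

/-- The factors of `P_n(k)` are nonnegative for `k ≤ n - 1`, `n ≤ N`. [cite: SalmhoferSeiler1991, (4.36)] -/
theorem sdProd_nonneg {N n k : ℕ} (hN : 1 ≤ N) (hn : n ≤ N) : 0 ≤ sdProd N n k := by
  unfold sdProd
  refine Finset.prod_nonneg fun i _ => ?_
  have hNpos : (0 : ℝ) < N := Nat.cast_pos.mpr hN
  rw [sub_nonneg, div_le_one hNpos]
  exact_mod_cast (show n - 1 - i ≤ N by omega)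

/-- **Lemma 4.7, real-variable core.**  Let `N ≥ 1`, `w₁ = 1`, `w_k ≥ 0` (`2 ≤ k ≤ N`), and
`S : ℕ → ℝ` nonnegative with the Schwinger–Dyson inequality (4.35)
`∑_{u ≤ N} u w_u S_{j+u} ≤ (1 - j/N) S_j` for all `j` (i.e. `S_{j+1} + ∑_{u ≥ 2} u w_u S_{j+u} ≤
(1 - j/N) S_j`).  Then `S_n ≤ α_n S_1` for `1 ≤ n ≤ N` (4.28), by the induction (4.36)–(4.37).
[cite: SalmhoferSeiler1991, Lemma 4.7] -/
theorem le_sdAlpha_mul_of_sd {N : ℕ} (hN : 1 ≤ N) {w : ℕ → ℝ} (hw1 : w 1 = 1)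
    (hw : ∀ k, 2 ≤ k → k ≤ N → 0 ≤ w k) {S : ℕ → ℝ} (hS0 : ∀ n, 0 ≤ S n)
    (hsd : ∀ j : ℕ, ∑ u ∈ range (N + 1), (u : ℝ) * w u * S (j + u) ≤ (1 - (j : ℝ) / N) * S j)
    {n : ℕ} (hn1 : 1 ≤ n) (hnN : n ≤ N) : S n ≤ sdAlpha N w n * S 1 := by
  have hNpos : (0 : ℝ) < N := Nat.cast_pos.mpr hN
  have hw' : ∀ k, 1 ≤ k → k ≤ N → 0 ≤ w k := by
    intro k hk1 hkN
    rcases Nat.lt_or_ge k 2 with hk | hk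
    · rw [show k = 1 by omega, hw1]; exact zero_le_one
    · exact hw k hk hkN
  -- the terms of the SD sum are nonnegative
  have hterm : ∀ j u, u ∈ range (N + 1) → 0 ≤ (u : ℝ) * w u * S (j + u) := by
    intro j u hu
    have huN : u ≤ N := Nat.lt_succ_iff.mp (Finset.mem_range.mp hu)
    rcases Nat.eq_zero_or_pos u with rfl | hu1
    · simp
    · exact mul_nonneg (mul_nonneg (Nat.cast_nonneg u) (hw' u hu1 huN)) (hS0 _)
  -- (4.35) with only the `u = 1` term kept: `S_{j+1} ≤ (1 - j/N) S_j`
  have hstep1 : ∀ j : ℕ, S (j + 1) ≤ (1 - (j : ℝ) / N) * S j := by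
    intro j
    have h1 : (1 : ℕ) ∈ range (N + 1) := Finset.mem_range.mpr (by omega)
    have := Finset.single_le_sum (fun u hu => hterm j u hu) h1
    simp only [Nat.cast_one, one_mul, hw1] at this
    exact this.trans (hsd j)
  -- (4.35) with the `u = 1` and `u = k` terms kept
  have hstep2 : ∀ j k : ℕ, 2 ≤ k → k ≤ N →
      S (j + 1) + (k : ℝ) * w k * S (j + k) ≤ (1 - (j : ℝ) / N) * S j := by
    intro j k hk2 hkN
    have hsub : ({1, k} : Finset ℕ) ⊆ range (N + 1) := by
      intro u hu
      rw [Finset.mem_insert, Finset.mem_singleton] at hu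
      rw [Finset.mem_range]; omega
    have := Finset.sum_le_sum_of_subset_of_nonneg hsub (fun u hu _ => hterm j u hu)
    rw [Finset.sum_pair (by omega : (1 : ℕ) ≠ k)] at this
    simp only [Nat.cast_one, one_mul, hw1] at this
    exact this.trans (hsd j)
  -- the case `n = 1`
  rcases Nat.lt_or_ge n 2 with hn | hn2
  · rw [show n = 1 by omega, sdAlpha_one, one_mul]
  -- (4.36) by induction on `k' = k - 1`: `S_n (1 + ∑_{i<k'} …) ≤ P(k'+1) S_{n-k'-1}` for `k' ≤ n-2`
  have hind : ∀ k' : ℕ, k' ≤ n - 2 →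
      S n * (1 + ∑ i ∈ range k', ((i + 2 : ℕ) : ℝ) * w (i + 2) * sdProd N n (i + 1)) ≤
        sdProd N n (k' + 1) * S (n - k' - 1) := by
    intro k'
    induction k' with
    | zero =>
      intro _
      rw [Finset.sum_range_zero, add_zero, mul_one, sdProd, Finset.prod_range_one]
      have := hstep1 (n - 0 - 1)
      rw [show n - 0 - 1 + 1 = n by omega] at this
      simpa using this
    | succ k' ih =>
      intro hk'
      have ih' := ih (by omega)
      set j := n - k' - 2 with hj
      have hj1 : j + 1 = n - k' - 1 := by omega
      have hj2 : j + (k' + 2) = n := by omega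
      have h35 := hstep2 j (k' + 2) (by omega) (by omega)
      rw [hj1, hj2] at h35
      -- multiply (4.37) by `P(k'+1) ≥ 0`
      have hP : 0 ≤ sdProd N n (k' + 1) := sdProd_nonneg hN hnN
      have h37 := mul_le_mul_of_nonneg_left h35 hP
      have hPsucc : sdProd N n (k' + 1 + 1) = sdProd N n (k' + 1) * (1 - (j : ℝ) / N) := by
        rw [sdProd, Finset.prod_range_succ, ← sdProd]
        congr 2
        push_cast [hj]
        rw [show n - 1 - (k' + 1) = n - k' - 2 by omega]
      rw [Finset.sum_range_succ, show n - (k' + 1) - 1 = j by omega, hPsucc]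
      have hcast : ((k' + 2 : ℕ) : ℝ) = ((k' + 1 + 2 - 1 : ℕ) : ℝ) := by norm_num
      nlinarith [ih', h37, hS0 n, hS0 j]
  have hfin := hind (n - 2) le_rfl
  rw [show n - 2 + 1 = n - 1 by omega, show n - (n - 2) - 1 = 1 by omega] at hfin
  -- `P(n-1) = ∏_{p=1}^{n-1} (1 - p/N)` (reverse the order of the factors)
  have hrefl : sdProd N n (n - 1) = ∏ i ∈ range (n - 1), (1 - ((i + 1 : ℕ) : ℝ) / N) := by
    rw [sdProd, ← Finset.prod_range_reflect (fun i => (1 - ((i + 1 : ℕ) : ℝ) / N)) (n - 1)]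
    refine Finset.prod_congr rfl fun i hi => ?_
    have hi' := Finset.mem_range.mp hi
    rw [show n - 1 - 1 - i + 1 = n - 1 - i by omega]
  -- the denominator is `≥ 1 > 0`
  have hden : 0 < 1 + ∑ i ∈ range (n - 2), ((i + 2 : ℕ) : ℝ) * w (i + 2) * sdProd N n (i + 1) := by
    have : 0 ≤ ∑ i ∈ range (n - 2), ((i + 2 : ℕ) : ℝ) * w (i + 2) * sdProd N n (i + 1) := by
      refine Finset.sum_nonneg fun i hi => ?_
      have hi' := Finset.mem_range.mp hi
      exact mul_nonneg (mul_nonneg (Nat.cast_nonneg _) (hw (i + 2) (by omega) (by omega)))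
        (sdProd_nonneg hN hnN)
    linarith
  rw [sdAlpha, ← hrefl, div_mul_eq_mul_div, le_div_iff₀ hden]
  linarith [hfin]

/-! ### Lemma 4.7 for the brackets, and (4.38) -/

/-- A neighbour `x ± e_μ` differs from `x` (side `L ≥ 2`). [folklore] -/
private theorem nbr_ne (hL : 2 ≤ L) (x : TorusSite ν L) (s : Fin ν × Bool) : x ≠ nbr x s := by
  unfold nbr
  split_ifs
  · exact (add_single_ne_self hL x s.1).symm
  · intro h
    have := add_single_ne_self hL (x - Pi.single s.1 1) s.1
    rw [sub_add_cancel] at this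
    exact this h

/-- `σ_x∂_x (σ_xσ_y)^j = j (σ_xσ_y)^j` for `y ≠ x`. [folklore] -/
private theorem euler_XX_pow_of_ne {x y : TorusSite ν L} (hxy : x ≠ y) (j : ℕ) :
    euler x ((X x * X y : MvPolynomial (TorusSite ν L) ℝ) ^ j) = C (j : ℝ) * (X x * X y) ^ j := by
  classical
  rw [euler_XX_pow, Finsupp.add_apply, Finsupp.single_eq_same, Finsupp.single_eq_of_ne hxy,
    add_zero]

variable [NeZero L]

/-- **"`σ_z^{N+1}` appears in the numerator of the contour integral"**: a high observable has
`[Φ]_Λ = 0`. [cite: SalmhoferSeiler1991, proof of (3.44)] -/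
theorem bracket_eq_zero_of_highDeg {N : ℕ} {z : TorusSite ν L} (m : ℝ) (a : ℕ → ℝ)
    {Φ : MvPolynomial (TorusSite ν L) ℝ} (h : HighDeg N z Φ) : bracket N m a Φ = 0 := by
  unfold bracket
  by_contra hne
  have := h.mul_right (boltzmann N m a) _ hne
  rw [topExponent_apply'] at this
  exact lt_irrefl N this

/-- **Integration by parts**: `[σ_z ∂_z P]` picks up the factor `N` — the coefficient of `∏_x σ_x^N`
in `σ_z∂_z P` is `N` times that in `P`. [cite: SalmhoferSeiler1991, (3.45)] -/
theorem coeff_topExponent_euler (N : ℕ) (z : TorusSite ν L) (P : MvPolynomial (TorusSite ν L) ℝ) :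
    coeff (topExponent N) (euler z P) = (N : ℝ) * coeff (topExponent N) P := by
  rw [coeff_euler, topExponent_apply']


/-- `[0]_Λ = 0`. [cite: SalmhoferSeiler1991, (3.1)–(3.2)] -/
theorem bracket_zero (N : ℕ) (m : ℝ) (a : ℕ → ℝ) :
    bracket (ν := ν) (L := L) N m a 0 = 0 := by
  rw [bracket, zero_mul, coeff_zero]

/-- **`σ_z∂_z` of the Boltzmann polynomial**: modulo terms containing `σ_z^{N+1}`,
`σ_z∂_z (∏ F ∏ B) = (2Nm σ_z + N ∑_{bonds b ∋ z} σσ' W'(σσ')_b) · ∏ F ∏ B` — the integrand of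
(3.44) after integration by parts. [cite: SalmhoferSeiler1991, (3.44)–(3.46)] -/
theorem euler_boltzmann {N : ℕ} {a w : ℕ → ℝ} (hlog : HasLog N a w) (hL : 2 ≤ L) (m : ℝ)
    (z : TorusSite ν L) :
    ∃ H, HighDeg N z H ∧
      euler z (boltzmann N m a) =
        (C (2 * N * m) * X z + C (N : ℝ) * linkSum N w z) * boltzmann N m a + H := by
  classical
  -- sites
  obtain ⟨HS, hHS, hS⟩ := euler_prod_of (N := N) (z := z) (Finset.univ : Finset (TorusSite ν L))
    (fun x => siteWeight N m x) (fun x => if x = z then C (2 * N * m) * X z else 0)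
    (by
      intro x _
      by_cases hx : x = z
      · subst hx
        obtain ⟨h, hh, he⟩ := euler_siteWeight_self (ν := ν) (L := L) N m x
        exact ⟨h, hh, by rw [he, if_pos rfl]⟩
      · refine ⟨0, HighDeg.zero N z, ?_⟩
        rw [euler_siteWeight_of_ne (Ne.symm hx), if_neg hx, zero_mul, zero_add])
  -- bonds, as a product over the links `(x, μ)`
  set q : TorusSite ν L × Fin ν → MvPolynomial (TorusSite ν L) ℝ := fun l =>
    (if l.1 = z then C (N : ℝ) * omega N w l.1 (l.1 + Pi.single l.2 1) else 0) +
      (if l.1 + Pi.single l.2 1 = z then C (N : ℝ) * omega N w l.1 (l.1 + Pi.single l.2 1) else 0)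
    with hq
  obtain ⟨HB, hHB, hB⟩ := euler_prod_of (N := N) (z := z)
    (Finset.univ : Finset (TorusSite ν L × Fin ν))
    (fun l => bondWeight N a l.1 (l.1 + Pi.single l.2 1)) q
    (by
      rintro ⟨x, μ⟩ _
      dsimp only
      have hne : x ≠ x + Pi.single μ 1 := (add_single_ne_self hL x μ).symm
      by_cases hx : x = z
      · subst hx
        obtain ⟨h, hh, he⟩ := euler_bondWeight_left (ν := ν) (L := L) hlog hne
        refine ⟨h, hh, ?_⟩
        rw [he, hq]
        simp [hne.symm]
      · by_cases hy : x + Pi.single μ 1 = z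
        · subst hy
          obtain ⟨h, hh, he⟩ := euler_bondWeight_right (ν := ν) (L := L) hlog hne
          refine ⟨h, hh, ?_⟩
          rw [he, hq]
          simp [hne]
        · refine ⟨0, HighDeg.zero N z, ?_⟩
          rw [euler_bondWeight_of_ne (Ne.symm hx) (Ne.symm hy), hq]
          simp [hx, hy])
  -- the sum of the bond multipliers is `N · linkSum`
  have hA : ∑ l : TorusSite ν L × Fin ν,
      (if l.1 = z then C (N : ℝ) * omega N w l.1 (l.1 + Pi.single l.2 1) else 0) =
      ∑ μ : Fin ν, C (N : ℝ) * omega N w z (z + Pi.single μ 1) := by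
    rw [Fintype.sum_prod_type]
    dsimp only
    rw [Finset.sum_comm]
    refine Finset.sum_congr rfl fun μ _ => ?_
    rw [Finset.sum_ite_eq' Finset.univ z, if_pos (Finset.mem_univ z)]
  have hB' : ∑ l : TorusSite ν L × Fin ν,
      (if l.1 + Pi.single l.2 1 = z then C (N : ℝ) * omega N w l.1 (l.1 + Pi.single l.2 1)
        else 0) =
      ∑ μ : Fin ν, C (N : ℝ) * omega N w (z - Pi.single μ 1) z := by
    rw [Fintype.sum_prod_type]
    dsimp only
    rw [Finset.sum_comm]
    refine Finset.sum_congr rfl fun μ _ => ?_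
    rw [Finset.sum_eq_single (z - Pi.single μ 1)]
    · rw [if_pos (sub_add_cancel z _), sub_add_cancel]
    · intro x _ hx
      rw [if_neg]
      intro h
      exact hx (by rw [← h, add_sub_cancel_right])
    · intro h
      exact absurd (Finset.mem_univ _) h
  have hqsum : ∑ l : TorusSite ν L × Fin ν, q l = C (N : ℝ) * linkSum N w z := by
    simp only [hq]
    rw [Finset.sum_add_distrib, hA, hB', linkSum, Finset.mul_sum, ← Finset.sum_add_distrib]
    refine Finset.sum_congr rfl fun μ _ => ?_
    rw [mul_add]
  -- assemble
  have hbonds : (∏ x : TorusSite ν L, ∏ μ : Fin ν, bondWeight N a x (x + Pi.single μ 1)) =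
      ∏ l : TorusSite ν L × Fin ν, bondWeight N a l.1 (l.1 + Pi.single l.2 1) := by
    rw [Fintype.prod_prod_type]
  have hsites : ∑ x : TorusSite ν L, (if x = z then C (2 * N * m) * X z else 0) =
      C (2 * N * m) * X z := by
    rw [Finset.sum_ite_eq' Finset.univ z, if_pos (Finset.mem_univ z)]
  refine ⟨HS * ∏ l : TorusSite ν L × Fin ν, bondWeight N a l.1 (l.1 + Pi.single l.2 1) +
      (∏ x, siteWeight N m x) * HB, (hHS.mul_right _).add (hHB.mul_left _), ?_⟩
  rw [boltzmann, hbonds, euler_mul, hS, hB, hsites, hqsum]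
  ring

/-! ### The Schwinger–Dyson equations -/

/-- **The Schwinger–Dyson equation (3.44)/(3.46), unnormalised and for an arbitrary observable**:
for the complex spin system with `F = e^{2Nmσ}` and `B = exp(NW)` (to order `N`, `HasLog N a w`) on
a torus of side `L ≥ 2`, and every `Φ` and site `x`,
`N [Φ]_Λ = [σ_x∂_x Φ]_Λ + 2Nm [σ_x Φ]_Λ + N [ (∑_{y:|y-x|=1} σ_xσ_y W'(σ_xσ_y)) Φ ]_Λ`
("integration by parts with respect to `σ_x`"; for `Φ = σ^L`, `σ_x∂_xΦ = L_x Φ` and this is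
(3.46) multiplied by `N Z_Λ`). [cite: SalmhoferSeiler1991, (3.44)–(3.46)] -/
theorem schwingerDyson {N : ℕ} {a w : ℕ → ℝ} (hlog : HasLog N a w) (hL : 2 ≤ L) (m : ℝ)
    (x : TorusSite ν L) (Φ : MvPolynomial (TorusSite ν L) ℝ) :
    (N : ℝ) * bracket N m a Φ =
      bracket N m a (euler x Φ) + 2 * N * m * bracket N m a (X x * Φ) +
        N * bracket N m a (linkSum N w x * Φ) := by
  obtain ⟨H, hH, hE⟩ := euler_boltzmann (ν := ν) (L := L) hlog hL m x
  have h1 : (N : ℝ) * bracket N m a Φ = coeff (topExponent N) (euler x (Φ * boltzmann N m a)) := by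
    rw [coeff_topExponent_euler, bracket]
  have h2 : Φ * ((C (2 * ↑N * m) * X x + C (N : ℝ) * linkSum N w x) * boltzmann N m a + H) =
      (C (2 * N * m) * (X x * Φ) + C (N : ℝ) * (linkSum N w x * Φ)) * boltzmann N m a + Φ * H := by
    ring
  have h3 : coeff (topExponent N) (Φ * H) = 0 := by
    by_contra hne
    have := (hH.mul_left Φ) _ hne
    rw [topExponent_apply'] at this
    exact lt_irrefl N this
  rw [h1, euler_mul, hE, coeff_add, h2, coeff_add, h3, add_zero]
  change bracket N m a (euler x Φ) + bracket N m a _ = _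
  rw [bracket_add, bracket_C_mul, bracket_C_mul]
  ring

/-- **The Schwinger–Dyson equation (3.46) for a homogeneous observable**: if `σ_x∂_x Φ = c Φ`
(e.g. `Φ = σ^L` with `L_x = c`), then
`(N - c) [Φ]_Λ = 2Nm [σ_x Φ]_Λ + N [(∑_{y:|y-x|=1} σ_xσ_y W'(σ_xσ_y)) Φ]_Λ`, i.e. (3.46)
`((N - L_x)/N) ⟨σ^L⟩ = 2m⟨σ_xσ^L⟩ + ∑_{y} ⟨σ_xσ_y W'(σ_xσ_y) σ^L⟩` times `N Z_Λ`.
[cite: SalmhoferSeiler1991, (3.46)] -/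
theorem schwingerDyson_of_euler_eq {N : ℕ} {a w : ℕ → ℝ} (hlog : HasLog N a w) (hL : 2 ≤ L)
    (m : ℝ) (x : TorusSite ν L) {Φ : MvPolynomial (TorusSite ν L) ℝ} {c : ℝ}
    (hΦ : euler x Φ = C c * Φ) :
    ((N : ℝ) - c) * bracket N m a Φ =
      2 * N * m * bracket N m a (X x * Φ) + N * bracket N m a (linkSum N w x * Φ) := by
  have h := schwingerDyson (ν := ν) (L := L) hlog hL m x Φ
  rw [hΦ, bracket_C_mul] at h
  linarith

/-- **(3.46) with `L = 0`** (the starting point (4.10)/(4.38) of Thms. 4.3 and 4.8):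
`Z_Λ = 2m [σ_x]_Λ + [∑_{y:|y-x|=1} σ_xσ_y W'(σ_xσ_y)]_Λ`, i.e.
`1 = 2m⟨σ_x⟩ + ∑_k k w_k ∑_{|y-x|=1} ⟨(σ_xσ_y)^k⟩`. [cite: SalmhoferSeiler1991, (3.46) and (4.38)] -/
theorem partitionFunction_eq_sd {N : ℕ} (hN : 1 ≤ N) {a w : ℕ → ℝ} (hlog : HasLog N a w)
    (hL : 2 ≤ L) (m : ℝ) (x : TorusSite ν L) :
    partitionFunction (ν := ν) (L := L) N m a =
      2 * m * bracket N m a (X x) + bracket N m a (linkSum N w x) := by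
  have h := schwingerDyson (ν := ν) (L := L) hlog hL m x 1
  rw [euler_one, mul_one, mul_one, bracket_zero, zero_add] at h
  have hN0 : (N : ℝ) ≠ 0 := by exact_mod_cast (show N ≠ 0 by omega)
  rw [partitionFunction]
  have : (N : ℝ) * bracket (ν := ν) (L := L) N m a 1 =
      N * (2 * m * bracket N m a (X x) + bracket N m a (linkSum N w x)) := by
    rw [h]; ring
  exact mul_left_cancel₀ hN0 this

/-- The Boltzmann polynomial has nonnegative coefficients for `m ≥ 0`, `a_k ≥ 0` (`k ≤ N`).
[cite: SalmhoferSeiler1991, proof of Thm. 3.18(1)] -/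
theorem nonnegCoeff_boltzmann (N : ℕ) {m : ℝ} (hm : 0 ≤ m) {a : ℕ → ℝ} (ha : ∀ k ≤ N, 0 ≤ a k) :
    NonnegCoeff (boltzmann (ν := ν) (L := L) N m a) := by
  unfold boltzmann
  exact (NonnegCoeff.prod _ fun x _ => nonnegCoeff_siteWeight N hm x).mul
    (NonnegCoeff.prod _ fun x _ => NonnegCoeff.prod _ fun μ _ => nonnegCoeff_bondWeight N ha _ _)

/-- **Positivity (Thm. 3.18(1), first half: `0 ≤ ⟨σ^L⟩_Λ`)** at the level of the bracket: for
`m ≥ 0` and `a_k ≥ 0` (`k ≤ N`), every observable with nonnegative coefficients — in particular every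
monomial `σ^L` — has `[Φ]_Λ ≥ 0` ("clear from the monomer-dimer representation because `m ≥ 0`
and all `w_k ≥ 0`"). [cite: SalmhoferSeiler1991, Thm. 3.18(1)] -/
theorem bracket_nonneg (N : ℕ) {m : ℝ} (hm : 0 ≤ m) {a : ℕ → ℝ} (ha : ∀ k ≤ N, 0 ≤ a k)
    {Φ : MvPolynomial (TorusSite ν L) ℝ} (hΦ : NonnegCoeff Φ) : 0 ≤ bracket N m a Φ :=
  (hΦ.mul (nonnegCoeff_boltzmann N hm ha)) _

/-- In particular `Z_Λ = [1]_Λ ≥ 0`. [cite: SalmhoferSeiler1991, Thm. 3.18(1)] -/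
theorem partitionFunction_nonneg_of_coeff (N : ℕ) {m : ℝ} (hm : 0 ≤ m) {a : ℕ → ℝ}
    (ha : ∀ k ≤ N, 0 ≤ a k) : 0 ≤ partitionFunction (ν := ν) (L := L) N m a :=
  bracket_nonneg N hm ha NonnegCoeff.one

/-! ### Lemma 4.7 for the brackets, and (4.38) (continued) -/

/-- `[σ_xσ_y W'(σ_xσ_y) · (σ_xσ_y)^j] = ∑_u u w_u [(σ_xσ_y)^{j+u}]` — the `y`-term of the SD equation
for `σ^L = (σ_xσ_y)^j`, i.e. the left side of (4.32). [cite: SalmhoferSeiler1991, (4.31)–(4.32)] -/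
theorem bracket_omega_mul_pow (N : ℕ) (m : ℝ) (a w : ℕ → ℝ) (x y : TorusSite ν L) (j : ℕ) :
    bracket N m a (omega N w x y * (X x * X y) ^ j) =
      ∑ u ∈ range (N + 1), (u : ℝ) * w u * bracket N m a ((X x * X y) ^ (j + u)) := by
  unfold omega
  rw [Finset.sum_mul, bracket_sum]
  refine Finset.sum_congr rfl fun u _ => ?_
  rw [mul_assoc, bracket_C_mul, ← pow_add, add_comm u j]

/-- **(4.35) for the brackets**: for `m ≥ 0`, `w₁ = 1`, `w_k ≥ 0`, `B = exp(NW)` to order `N`, a site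
`x` and a neighbour `y = x ± e_μ`, the moments `S_j = [(σ_xσ_y)^j]_Λ` satisfy
`∑_u u w_u S_{j+u} ≤ (1 - j/N) S_j` — the SD equation (3.46) for `σ^L = (σ_xσ_y)^j` with the
nonnegative terms `R_j`, `T_j` (4.33)–(4.34) dropped. [cite: SalmhoferSeiler1991, (4.31)–(4.35)] -/
theorem sd_ineq_bracket_pow {N : ℕ} (hN : 1 ≤ N) {a w : ℕ → ℝ} (hlog : HasLog N a w) (ha0 : a 0 = 1)
    (hw1 : w 1 = 1) (hw : ∀ k, 2 ≤ k → k ≤ N → 0 ≤ w k) (hL : 2 ≤ L) {m : ℝ} (hm : 0 ≤ m)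
    (x : TorusSite ν L) (s : Fin ν × Bool) (j : ℕ) :
    ∑ u ∈ range (N + 1), (u : ℝ) * w u * bracket N m a ((X x * X (nbr x s)) ^ (j + u)) ≤
      (1 - (j : ℝ) / N) * bracket N m a ((X x * X (nbr x s)) ^ j) := by
  classical
  have hw' : ∀ k, 1 ≤ k → k ≤ N → 0 ≤ w k := by
    intro k hk1 hkN
    rcases Nat.lt_or_ge k 2 with hk | hk
    · rw [show k = 1 by omega, hw1]; exact zero_le_one
    · exact hw k hk hkN
  have ha := hlog.coeff_nonneg ha0 hw'
  have hNpos : (0 : ℝ) < N := Nat.cast_pos.mpr hN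
  -- the SD equation for `Φ = (σ_xσ_y)^j`
  have hsd := schwingerDyson_of_euler_eq (ν := ν) (L := L) hlog hL m x
    (euler_XX_pow_of_ne (nbr_ne hL x s) j)
  set y := nbr x s with hy
  set Φ : MvPolynomial (TorusSite ν L) ℝ := (X x * X y) ^ j with hΦ
  have hΦnn : NonnegCoeff Φ := ((NonnegCoeff.X x).mul (NonnegCoeff.X y)).pow j
  -- `linkSum = ω(x,y) + rest`, `rest` with nonnegative coefficients
  have hsplit : linkSum N w x = omega N w x y + ∑ s' ∈ Finset.univ.erase s, omega N w x (nbr x s') := by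
    rw [linkSum_eq_sum_nbr, ← Finset.add_sum_erase _ _ (Finset.mem_univ s)]
  have hrest : 0 ≤ bracket N m a ((∑ s' ∈ Finset.univ.erase s, omega N w x (nbr x s')) * Φ) :=
    bracket_nonneg N hm ha ((NonnegCoeff.sum _ fun s' _ => nonnegCoeff_omega N hw' x _).mul hΦnn)
  have hR : 0 ≤ bracket N m a (X x * Φ) := bracket_nonneg N hm ha ((NonnegCoeff.X x).mul hΦnn)
  have hlink : bracket N m a (linkSum N w x * Φ) =
      bracket N m a (omega N w x y * Φ) +
        bracket N m a ((∑ s' ∈ Finset.univ.erase s, omega N w x (nbr x s')) * Φ) := by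
    rw [hsplit, add_mul, bracket_add]
  rw [← bracket_omega_mul_pow]
  -- `N [ωΦ] ≤ N [linkSum Φ] + 2Nm [σ_x Φ] = (N - j) [Φ]`
  have h1 : (N : ℝ) * bracket N m a (omega N w x y * Φ) ≤ ((N : ℝ) - j) * bracket N m a Φ := by
    rw [hsd, hlink]
    have h4 : 0 ≤ 2 * (N : ℝ) * m * bracket N m a (X x * Φ) := by positivity
    have h5 : 0 ≤ (N : ℝ) * bracket N m a
        ((∑ s' ∈ Finset.univ.erase s, omega N w x (nbr x s')) * Φ) := by positivity
    linarith
  have h2 : bracket N m a (omega N w x y * Φ) ≤ (((N : ℝ) - j) / N) * bracket N m a Φ := by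
    rw [div_mul_eq_mul_div, le_div_iff₀ hNpos]
    linarith
  have h3 : ((N : ℝ) - j) / N = 1 - (j : ℝ) / N := by
    field_simp
  rw [h3] at h2
  exact h2

/-- **Lemma 4.7 (4.28) for the brackets**: for `m ≥ 0`, `w₁ = 1`, `w_k ≥ 0` (`2 ≤ k ≤ N`),
`B = exp(NW)` to order `N`, a site `x`, a neighbour `y = x ± e_μ` and `1 ≤ n ≤ N`,
`[(σ_xσ_y)ⁿ]_Λ ≤ α_n [σ_xσ_y]_Λ` (no division by `Z_Λ` needed; for `Z_Λ > 0` this is (4.28) as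
printed, for every neighbour, not only `x + e₁`). [cite: SalmhoferSeiler1991, Lemma 4.7] -/
theorem bracket_pow_le_sdAlpha_mul {N : ℕ} (hN : 1 ≤ N) {a w : ℕ → ℝ} (hlog : HasLog N a w)
    (ha0 : a 0 = 1) (hw1 : w 1 = 1) (hw : ∀ k, 2 ≤ k → k ≤ N → 0 ≤ w k) (hL : 2 ≤ L) {m : ℝ}
    (hm : 0 ≤ m) (x : TorusSite ν L) (s : Fin ν × Bool) {n : ℕ} (hn1 : 1 ≤ n) (hnN : n ≤ N) :
    bracket N m a ((X x * X (nbr x s)) ^ n) ≤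
      sdAlpha N w n * bracket N m a (X x * X (nbr x s)) := by
  have hw' : ∀ k, 1 ≤ k → k ≤ N → 0 ≤ w k := by
    intro k hk1 hkN
    rcases Nat.lt_or_ge k 2 with hk | hk
    · rw [show k = 1 by omega, hw1]; exact zero_le_one
    · exact hw k hk hkN
  have ha := hlog.coeff_nonneg ha0 hw'
  have h := le_sdAlpha_mul_of_sd hN hw1 hw
    (S := fun j => bracket N m a ((X x * X (nbr x s)) ^ j))
    (fun j => bracket_nonneg N hm ha (((NonnegCoeff.X x).mul (NonnegCoeff.X _)).pow j))
    (fun j => sd_ineq_bracket_pow hN hlog ha0 hw1 hw hL hm x s j) hn1 hnN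
  simpa only [pow_one] using h

/-- **(4.38), the equality**: `Z_Λ = 2m [σ_x]_Λ + ∑_{|y-x|=1} ∑_{k} k w_k [(σ_xσ_y)^k]_Λ`
(the SD equation for `L = 0`). [cite: SalmhoferSeiler1991, (4.38)] -/
theorem partitionFunction_eq_sd' {N : ℕ} (hN : 1 ≤ N) {a w : ℕ → ℝ} (hlog : HasLog N a w)
    (hL : 2 ≤ L) (m : ℝ) (x : TorusSite ν L) :
    partitionFunction (ν := ν) (L := L) N m a =
      2 * m * bracket N m a (X x) +
        ∑ s : Fin ν × Bool, ∑ k ∈ range (N + 1),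
          (k : ℝ) * w k * bracket N m a ((X x * X (nbr x s)) ^ k) := by
  rw [partitionFunction_eq_sd hN hlog hL m x, linkSum_eq_sum_nbr, bracket_sum]
  congr 1
  refine Finset.sum_congr rfl fun s _ => ?_
  have := bracket_omega_mul_pow (ν := ν) (L := L) N m a w x (nbr x s) 0
  rw [pow_zero, mul_one] at this
  rw [this]
  simp only [zero_add]

/-- **(4.38), the inequality**: for `m ≥ 0`, `w₁ = 1`, `w_k ≥ 0` (`2 ≤ k ≤ N`), `B = exp(NW)` to
order `N`, side `L ≥ 2`:
`Z_Λ ≤ 2m [σ_x]_Λ + K(N) ∑_{|y-x|=1} [σ_xσ_y]_Λ`, i.e. `1 ≤ 2m⟨σ_x⟩ + K(N) ∑_{|y-x|=1}⟨σ_xσ_y⟩`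
with `K(N) = ∑_k k w_k α_k` (4.39) ("the inequality comes from application of Lemma 4.7").
[cite: SalmhoferSeiler1991, (4.38)–(4.39)] -/
theorem partitionFunction_le_sd {N : ℕ} (hN : 1 ≤ N) {a w : ℕ → ℝ} (hlog : HasLog N a w)
    (ha0 : a 0 = 1) (hw1 : w 1 = 1) (hw : ∀ k, 2 ≤ k → k ≤ N → 0 ≤ w k) (hL : 2 ≤ L) {m : ℝ}
    (hm : 0 ≤ m) (x : TorusSite ν L) :
    partitionFunction (ν := ν) (L := L) N m a ≤
      2 * m * bracket N m a (X x) +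
        sdK N w * ∑ s : Fin ν × Bool, bracket N m a (X x * X (nbr x s)) := by
  have hw' : ∀ k, 1 ≤ k → k ≤ N → 0 ≤ w k := by
    intro k hk1 hkN
    rcases Nat.lt_or_ge k 2 with hk | hk
    · rw [show k = 1 by omega, hw1]; exact zero_le_one
    · exact hw k hk hkN
  rw [partitionFunction_eq_sd' hN hlog hL m x, sdK, Finset.mul_sum]
  refine add_le_add_right (Finset.sum_le_sum fun s _ => ?_) _
  rw [Finset.sum_mul]
  refine Finset.sum_le_sum fun k hk => ?_
  have hkN : k ≤ N := Nat.lt_succ_iff.mp (Finset.mem_range.mp hk)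
  rcases Nat.eq_zero_or_pos k with rfl | hk1
  · simp
  · have hcoef : 0 ≤ (k : ℝ) * w k := mul_nonneg (Nat.cast_nonneg k) (hw' k hk1 hkN)
    have := bracket_pow_le_sdAlpha_mul hN hlog ha0 hw1 hw hL hm x s hk1 hkN
    calc (k : ℝ) * w k * bracket N m a ((X x * X (nbr x s)) ^ k)
        ≤ (k : ℝ) * w k * (sdAlpha N w k * bracket N m a (X x * X (nbr x s))) :=
          mul_le_mul_of_nonneg_left this hcoef
      _ = (k : ℝ) * w k * sdAlpha N w k * bracket N m a (X x * X (nbr x s)) := by ring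

end ComplexSpin

end Literature.MathematicalPhysics.StatisticalMechanics

end
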